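import Literature.MathematicalPhysics.QuantumFieldTheory.Balaban1983to89.Beta.Envelope
import Summits.QuantumFields.BalabanUV.Beta.GAN24.DerivativeRateTransfer

/-!
# `BalabanUV.Beta.GAN24.DerivativeRateTransferEnvelope` — binder row G-an2-4 ∕ (CONV-C), route R6 «VALUES, NOT DERIVATIVES», PART 5:
# step S3 («uniform Taylor bounds one order up») FOR THE VALUE BLOCK `Σ = P⁻¹` AND THE MINIMISER BLOCK `Ξ = H` OF `M_k(B)⁻¹`, FIRST ORDER,
# FROM UNIFORM BOUNDS ALONG THE BACKGROUND FAMILY — by the EXACT envelope identities of `Beta.Envelope` (an1), no analyticity, no Cauchy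
# estimate (unit b2b-balaban-gan24-p3, gen 24; v1)

NOT IN PRINT; OUR PROOF ATTEMPT (for the ROUTE; every statement below is [folklore] finite-dimensional algebra + the triangle inequality in
the `ℓ²`-operator norm).  HONEST FRAMING (cell contract, verbatim): «discharging `BetaPertH` makes Bałaban's UV stability UNCONDITIONAL — a
real constructive-QFT result; it is NOT the continuum limit and NOT the Clay problem.»  HONEST DEPENDENCY (verbatim): «continuum YM on T⁴ ⇐
BetaPertH ∧ nine spine estimates (0/9 proved); BetaPertH ⇐ (D1) ∧ (D4) ∧ CAP+tail; G-an2-4 gates asym, D1 and NE2/3/4.»  Route R6, steps S1–S6: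
header of PART 1 (`GAN24.DerivativeRateTransfer`).

WHY THIS FILE.  R6-S3 (ROUTES-GAN24 v4 §2) asks, uniformly in `k`, for the first-order Taylor form `|∂_sF_k(0)·2h − (F_k(h) − F_k(−h))| ≤ Mh²`
of the block entries `F_k(s)` of `M_k(B(s))⁻¹` along a background family, and books it as «(H2)-technology one order up ∕ B9 Thm 3.4 analyticity
+ Cauchy; Lean size L».  For the two blocks that are VALUE-TYPE functions of the fine form `K(s)` at FIXED constraint map `Q` — the effective
form `Σ(s) = P(s)⁻¹ = (Q K(s)⁻¹ Qᵀ)⁻¹` and the minimiser `Ξ(s) = H(s) = K(s)⁻¹Qᵀ P(s)⁻¹` — the an1 lineage's EXACT identities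
([`Beta.Envelope`] `value_sub_value₂`: `P₁⁻¹ − P₀⁻¹ = H₀ᴸ E H₀ − H₀ᴸ E G₀ E H₁`, `minMap_sub_minMap`: `H₁ − H₀ = −G₀ E H₁`, `E = K₁ − K₀`) give
S3 at once from UNIFORM BOUNDS ALONG THE FAMILY: `‖H(s)‖, ‖H(0)ᴸ‖ ≤ B_H`, `‖G(0)‖ ≤ B_G` (the printed KIND of bound on Bałaban's minimisers ∕
propagators at background, [Balaban1985BackgroundPropagators] Thms 3.1–3.4 — CONTEXT, nothing printed is used), a Lipschitz bound
`‖K(s) − K(0)‖ ≤ L_K|s|` and the first-order Taylor form `‖K(h) − K(−h) − 2h·K′‖ ≤ M_K h²` of the FINE form itself (LOCAL vertex data: the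
background enters the fine Wilson Hessian polynomially ∕ analytically in the bond variables, AN1 §4 Table T rows T1–T3).  The derivative
insertions are then `∂_sΣ(0) = H₀ᴸ K′ H₀` (frozen minimisers — AN1 Table T row T4's envelope remark) and `∂_sΞ(0) = −G₀ K′ H₀`, with Taylor
constants `B_H²(M_K + 2B_G L_K²)` resp. `B_G B_H(M_K + 2B_G L_K²)`.  So for these blocks S3 costs NO new estimate beyond S2-type uniform bounds;
what this file does NOT cover: the variation of the constraint map `Q(B)` itself (Table T rows T7∕T8 — covariant averaging; the identities assume
a fixed `Q`), the fluctuation block `Γ` (needs the constrained-resolvent identity `G₁ − G₀ = −G₀EG₁`, not in `Beta.Envelope` v1.2), second order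
(`value_sub_value₂` one order further), and every instantiation on Bałaban's objects (S2, cell-wide debt).

WHAT THIS FILE PROVES (0 sorry; complex matrices, `ℓ²`-operator norm `Matrix.Norms.L2Operator`; imports an1's `Beta.Envelope` and PART 1):
§1 `norm_mul₃_le`, `norm_mul₅_le` (submultiplicativity chains for rectangular matrices, `Matrix.l2_opNorm_mul`);
§2 **`value_sym_diff_eq`** — the exact identity `P(h)⁻¹ − P(−h)⁻¹ − 2h·H₀ᴸK′H₀ = H₀ᴸ(K(h) − K(−h) − 2h·K′)H₀ − (H₀ᴸE₊G₀E₊H₊ − H₀ᴸE₋G₀E₋H₋)` and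
   **`value_taylor_form`** — `‖P(h)⁻¹ − P(−h)⁻¹ − 2h·H₀ᴸK′H₀‖ ≤ B_H²(M_K + 2B_G L_K²)·h²` for `0 < h ≤ γ`;
§3 **`minMap_sym_diff_eq`**, **`minMap_taylor_form`** — `‖H(h) − H(−h) + 2h·G₀K′H₀‖ ≤ B_G B_H(M_K + 2B_G L_K²)·h²`;
§4 entry read-outs `value_taylor_form_entry_re` ∕ `minMap_taylor_form_entry_re` (real parts of entries, `|Re z| ≤ ‖A‖` via NE2's
   `BalabanAveragedTowerUnit.norm_entry_le_opNorm`) — literally the `taylor` field of PART 1's `TransferInput₁` for the entry families, so that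
   `deriv_step_supRate` ∕ `convC_deriv₁` apply once S1 (value rate on the family) is supplied.
SUPPLIER work on the route of record; NOT one of the nine spine estimates; NEVER «G-an2-4 closed»; NOT (CONV-C), NOT D1, NOT `BetaPertH`, NOT
continuum, NOT Clay.  Records: `HOME/b2b-balaban-gan24-p3/WOODBURY-FIBRE.md` v12.3, `HOME/BETA/GAN24-NAMES.md` § gan24-p3 gen 24.
-/

noncomputable section

open scoped Matrix Matrix.Norms.L2Operator

namespace Summit.QuantumFields.BalabanUV.Beta.GAN24.DerivativeRateTransferEnvelope

open Literature.MathematicalPhysics.QuantumFieldTheory.Balaban1983to89.Beta.Composition (blockProp)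
open Literature.MathematicalPhysics.QuantumFieldTheory.Balaban1983to89.Beta.Envelope
  (minMap minMapL constrProp value_sub_value₂ minMap_sub_minMap)
open Summit.QuantumFields.BalabanUV.T4Continuum.BalabanAveragedTowerUnit (norm_entry_le_opNorm)

variable {ν μ : Type*} [Fintype ν] [Fintype μ] [DecidableEq ν] [DecidableEq μ]

/-! ## §1 Submultiplicativity chains -/

/-- `‖ABC‖ ≤ ‖A‖‖B‖‖C‖` for rectangular complex matrices in the `ℓ²`-operator norm. -/
theorem norm_mul₃_le {α β γ' δ : Type*} [Fintype α] [Fintype β] [Fintype γ'] [Fintype δ] [DecidableEq α] [DecidableEq β]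
    [DecidableEq γ'] [DecidableEq δ] (A : Matrix α β ℂ) (B : Matrix β γ' ℂ) (C : Matrix γ' δ ℂ) :
    ‖A * B * C‖ ≤ ‖A‖ * ‖B‖ * ‖C‖ :=
  (Matrix.l2_opNorm_mul _ _).trans (mul_le_mul_of_nonneg_right (Matrix.l2_opNorm_mul _ _) (norm_nonneg _))

/-- `‖ABCDE‖ ≤ ‖A‖‖B‖‖C‖‖D‖‖E‖`. -/
theorem norm_mul₅_le {α β γ' δ ε' ζ : Type*} [Fintype α] [Fintype β] [Fintype γ'] [Fintype δ] [Fintype ε'] [Fintype ζ]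
    [DecidableEq α] [DecidableEq β] [DecidableEq γ'] [DecidableEq δ] [DecidableEq ε'] [DecidableEq ζ]
    (A : Matrix α β ℂ) (B : Matrix β γ' ℂ) (C : Matrix γ' δ ℂ) (D : Matrix δ ε' ℂ) (E : Matrix ε' ζ ℂ) :
    ‖A * B * C * D * E‖ ≤ ‖A‖ * ‖B‖ * ‖C‖ * ‖D‖ * ‖E‖ := by
  calc ‖A * B * C * D * E‖ ≤ ‖A * B * C * D‖ * ‖E‖ := Matrix.l2_opNorm_mul _ _
    _ ≤ ‖A * B * C‖ * ‖D‖ * ‖E‖ := by gcongr; exact Matrix.l2_opNorm_mul _ _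
    _ ≤ ‖A‖ * ‖B‖ * ‖C‖ * ‖D‖ * ‖E‖ := by gcongr; exact norm_mul₃_le _ _ _

/-- Bounded version of `norm_mul₃_le`. -/
theorem norm_mul₃_le_of {α β γ' δ : Type*} [Fintype α] [Fintype β] [Fintype γ'] [Fintype δ] [DecidableEq α] [DecidableEq β]
    [DecidableEq γ'] [DecidableEq δ] {A : Matrix α β ℂ} {B : Matrix β γ' ℂ} {C : Matrix γ' δ ℂ} {a b c : ℝ}
    (hA : ‖A‖ ≤ a) (hB : ‖B‖ ≤ b) (hC : ‖C‖ ≤ c) (hb : 0 ≤ b) :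
    ‖A * B * C‖ ≤ a * b * c := by
  have ha : 0 ≤ a := (norm_nonneg _).trans hA
  exact (norm_mul₃_le A B C).trans
    (mul_le_mul (mul_le_mul hA hB (norm_nonneg _) ha) hC (norm_nonneg _) (mul_nonneg ha hb))

/-- Bounded version of `norm_mul₅_le`. -/
theorem norm_mul₅_le_of {α β γ' δ ε' ζ : Type*} [Fintype α] [Fintype β] [Fintype γ'] [Fintype δ] [Fintype ε'] [Fintype ζ]
    [DecidableEq α] [DecidableEq β] [DecidableEq γ'] [DecidableEq δ] [DecidableEq ε'] [DecidableEq ζ]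
    {A : Matrix α β ℂ} {B : Matrix β γ' ℂ} {C : Matrix γ' δ ℂ} {D : Matrix δ ε' ℂ} {E : Matrix ε' ζ ℂ} {a b c d' e : ℝ}
    (hA : ‖A‖ ≤ a) (hB : ‖B‖ ≤ b) (hC : ‖C‖ ≤ c) (hD : ‖D‖ ≤ d') (hE : ‖E‖ ≤ e) :
    ‖A * B * C * D * E‖ ≤ a * b * c * d' * e := by
  have ha : 0 ≤ a := (norm_nonneg _).trans hA
  have hb : 0 ≤ b := (norm_nonneg _).trans hB
  have hc : 0 ≤ c := (norm_nonneg _).trans hC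
  have hd : 0 ≤ d' := (norm_nonneg _).trans hD
  refine (norm_mul₅_le A B C D E).trans ?_
  have h2 : ‖A‖ * ‖B‖ ≤ a * b := mul_le_mul hA hB (norm_nonneg _) ha
  have h3 : ‖A‖ * ‖B‖ * ‖C‖ ≤ a * b * c := mul_le_mul h2 hC (norm_nonneg _) (mul_nonneg ha hb)
  have h4 : ‖A‖ * ‖B‖ * ‖C‖ * ‖D‖ ≤ a * b * c * d' := mul_le_mul h3 hD (norm_nonneg _) (by positivity)
  exact mul_le_mul h4 hE (norm_nonneg _) (by positivity)

/-! ## §2 The value block `Σ(s) = P(s)⁻¹` -/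

section Value

variable (K : ℝ → Matrix ν ν ℂ) (Q : Matrix μ ν ℂ) (K1 : Matrix ν ν ℂ)

/-- **Exact symmetric-difference identity for the value block** (from `Beta.Envelope.value_sub_value₂` at `(K(0), K(±h))`):
`P(h)⁻¹ − P(−h)⁻¹ − 2h·H₀ᴸK′H₀ = H₀ᴸ·(K(h) − K(−h) − 2h·K′)·H₀ − (H₀ᴸE₊G₀E₊H₊ − H₀ᴸE₋G₀E₋H₋)`, `E_± = K(±h) − K(0)`. -/
theorem value_sym_diff_eq (h : ℝ) (hK0 : IsUnit (K 0).det) (hKp : IsUnit (K h).det) (hKm : IsUnit (K (-h)).det)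
    (hP0 : IsUnit (blockProp (K 0) Q).det) (hPp : IsUnit (blockProp (K h) Q).det) (hPm : IsUnit (blockProp (K (-h)) Q).det) :
    ((blockProp (K h) Q)⁻¹ - (blockProp (K (-h)) Q)⁻¹) - ((2 * h : ℂ)) • (minMapL (K 0) Q * K1 * minMap (K 0) Q)
      = minMapL (K 0) Q * ((K h - K (-h)) - ((2 * h : ℂ)) • K1) * minMap (K 0) Q
        - (minMapL (K 0) Q * (K h - K 0) * constrProp (K 0) Q * (K h - K 0) * minMap (K h) Q
          - minMapL (K 0) Q * (K (-h) - K 0) * constrProp (K 0) Q * (K (-h) - K 0) * minMap (K (-h)) Q) := by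
  have vp := value_sub_value₂ (K 0) (K h) Q hK0 hKp hP0 hPp
  have vm := value_sub_value₂ (K 0) (K (-h)) Q hK0 hKm hP0 hPm
  have e : (blockProp (K h) Q)⁻¹ - (blockProp (K (-h)) Q)⁻¹
      = ((blockProp (K h) Q)⁻¹ - (blockProp (K 0) Q)⁻¹) - ((blockProp (K (-h)) Q)⁻¹ - (blockProp (K 0) Q)⁻¹) := by abel
  rw [e, vp, vm]
  simp only [Matrix.mul_sub, Matrix.sub_mul, Matrix.mul_smul, Matrix.smul_mul]
  abel

variable {K Q K1}

/-- **S3, FIRST ORDER, FOR THE VALUE BLOCK** — from UNIFORM BOUNDS ALONG THE FAMILY: if on `|s| ≤ γ` the forms `K(s)` and block propagators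
are invertible, `‖H(s)‖ ≤ B_H`, `‖H(0)ᴸ‖ ≤ B_H`, `‖G(0)‖ ≤ B_G`, `‖K(s) − K(0)‖ ≤ L_K|s|`, and the fine form has the first-order Taylor form
`‖K(h) − K(−h) − 2h·K′‖ ≤ M_K h²` (`0 < h ≤ γ`), then
`‖P(h)⁻¹ − P(−h)⁻¹ − 2h·H₀ᴸK′H₀‖ ≤ B_H²·(M_K + 2B_G L_K²)·h²`. -/
theorem value_taylor_form {γ BH BG LK MK : ℝ}
    (hKu : ∀ s : ℝ, |s| ≤ γ → IsUnit (K s).det) (hPu : ∀ s : ℝ, |s| ≤ γ → IsUnit (blockProp (K s) Q).det)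
    (hH : ∀ s : ℝ, |s| ≤ γ → ‖minMap (K s) Q‖ ≤ BH) (hHL : ‖minMapL (K 0) Q‖ ≤ BH) (hG : ‖constrProp (K 0) Q‖ ≤ BG)
    (hLip : ∀ s : ℝ, |s| ≤ γ → ‖K s - K 0‖ ≤ LK * |s|)
    (hTay : ∀ h : ℝ, 0 < h → h ≤ γ → ‖(K h - K (-h)) - ((2 * h : ℂ)) • K1‖ ≤ MK * h ^ 2)
    {h : ℝ} (hh : 0 < h) (hhγ : h ≤ γ) :
    ‖((blockProp (K h) Q)⁻¹ - (blockProp (K (-h)) Q)⁻¹) - ((2 * h : ℂ)) • (minMapL (K 0) Q * K1 * minMap (K 0) Q)‖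
      ≤ BH ^ 2 * (MK + 2 * BG * LK ^ 2) * h ^ 2 := by
  have hγ : 0 ≤ γ := hh.le.trans hhγ
  have h0 : |(0:ℝ)| ≤ γ := by rwa [abs_zero]
  have hp : |h| ≤ γ := by rwa [abs_of_pos hh]
  have hm : |(-h)| ≤ γ := by rwa [abs_neg, abs_of_pos hh]
  rw [value_sym_diff_eq K Q K1 h (hKu 0 h0) (hKu h hp) (hKu _ hm) (hPu 0 h0) (hPu h hp) (hPu _ hm)]
  have hEp : ‖K h - K 0‖ ≤ LK * h := by simpa [abs_of_pos hh] using hLip h hp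
  have hEm : ‖K (-h) - K 0‖ ≤ LK * h := by simpa [abs_neg, abs_of_pos hh] using hLip (-h) hm
  have hMK : 0 ≤ MK * h ^ 2 := (norm_nonneg _).trans (hTay h hh hhγ)
  have t1 : ‖minMapL (K 0) Q * ((K h - K (-h)) - ((2 * h : ℂ)) • K1) * minMap (K 0) Q‖ ≤ BH * (MK * h ^ 2) * BH :=
    norm_mul₃_le_of hHL (hTay h hh hhγ) (hH 0 h0) hMK
  have t2 : ‖minMapL (K 0) Q * (K h - K 0) * constrProp (K 0) Q * (K h - K 0) * minMap (K h) Q‖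
      ≤ BH * (LK * h) * BG * (LK * h) * BH :=
    norm_mul₅_le_of hHL hEp hG hEp (hH h hp)
  have t3 : ‖minMapL (K 0) Q * (K (-h) - K 0) * constrProp (K 0) Q * (K (-h) - K 0) * minMap (K (-h)) Q‖
      ≤ BH * (LK * h) * BG * (LK * h) * BH :=
    norm_mul₅_le_of hHL hEm hG hEm (hH (-h) hm)
  calc _ ≤ ‖minMapL (K 0) Q * ((K h - K (-h)) - ((2 * h : ℂ)) • K1) * minMap (K 0) Q‖
        + ‖minMapL (K 0) Q * (K h - K 0) * constrProp (K 0) Q * (K h - K 0) * minMap (K h) Q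
          - minMapL (K 0) Q * (K (-h) - K 0) * constrProp (K 0) Q * (K (-h) - K 0) * minMap (K (-h)) Q‖ := norm_sub_le _ _
    _ ≤ BH * (MK * h ^ 2) * BH + (BH * (LK * h) * BG * (LK * h) * BH + BH * (LK * h) * BG * (LK * h) * BH) :=
        add_le_add t1 ((norm_sub_le _ _).trans (add_le_add t2 t3))
    _ = BH ^ 2 * (MK + 2 * BG * LK ^ 2) * h ^ 2 := by ring

end Value

/-! ## §3 The minimiser block `Ξ(s) = H(s)` -/

section Minimiser

variable (K : ℝ → Matrix ν ν ℂ) (Q : Matrix μ ν ℂ) (K1 : Matrix ν ν ℂ)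

/-- **Exact symmetric-difference identity for the minimiser block** (from `Beta.Envelope.minMap_sub_minMap` at `(K(0), K(±h))`, applied twice):
`H(h) − H(−h) + 2h·G₀K′H₀ = −G₀·(K(h) − K(−h) − 2h·K′)·H₀ + (G₀E₊G₀E₊H₊ − G₀E₋G₀E₋H₋)`. -/
theorem minMap_sym_diff_eq (h : ℝ) (hK0 : IsUnit (K 0).det) (hKp : IsUnit (K h).det) (hKm : IsUnit (K (-h)).det)
    (hP0 : IsUnit (blockProp (K 0) Q).det) (hPp : IsUnit (blockProp (K h) Q).det) (hPm : IsUnit (blockProp (K (-h)) Q).det) :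
    (minMap (K h) Q - minMap (K (-h)) Q) + ((2 * h : ℂ)) • (constrProp (K 0) Q * K1 * minMap (K 0) Q)
      = -(constrProp (K 0) Q * ((K h - K (-h)) - ((2 * h : ℂ)) • K1) * minMap (K 0) Q)
        + (constrProp (K 0) Q * (K h - K 0) * (constrProp (K 0) Q * (K h - K 0) * minMap (K h) Q)
          - constrProp (K 0) Q * (K (-h) - K 0) * (constrProp (K 0) Q * (K (-h) - K 0) * minMap (K (-h)) Q)) := by
  have mp := minMap_sub_minMap (K 0) (K h) Q hK0 hKp hP0 hPp
  have mm := minMap_sub_minMap (K 0) (K (-h)) Q hK0 hKm hP0 hPm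
  -- the inner products on the right are `−(H_± − H₀)`
  have ip : constrProp (K 0) Q * (K h - K 0) * minMap (K h) Q = -(minMap (K h) Q - minMap (K 0) Q) := by
    rw [mp, neg_neg]
  have im : constrProp (K 0) Q * (K (-h) - K 0) * minMap (K (-h)) Q = -(minMap (K (-h)) Q - minMap (K 0) Q) := by
    rw [mm, neg_neg]
  rw [ip, im]
  conv_lhs =>
    rw [show minMap (K h) Q - minMap (K (-h)) Q
        = (minMap (K h) Q - minMap (K 0) Q) - (minMap (K (-h)) Q - minMap (K 0) Q) from by abel, mp, mm]
  simp only [Matrix.mul_sub, Matrix.sub_mul, Matrix.mul_smul, Matrix.smul_mul, Matrix.mul_neg, Matrix.mul_assoc]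
  abel

variable {K Q K1}

/-- **S3, FIRST ORDER, FOR THE MINIMISER BLOCK** — from the same uniform bounds along the family:
`‖H(h) − H(−h) + 2h·G₀K′H₀‖ ≤ B_G B_H·(M_K + 2B_G L_K²)·h²` (`0 < h ≤ γ`); the derivative insertion is `∂_sH(0) = −G₀K′H₀`. -/
theorem minMap_taylor_form {γ BH BG LK MK : ℝ}
    (hKu : ∀ s : ℝ, |s| ≤ γ → IsUnit (K s).det) (hPu : ∀ s : ℝ, |s| ≤ γ → IsUnit (blockProp (K s) Q).det)
    (hH : ∀ s : ℝ, |s| ≤ γ → ‖minMap (K s) Q‖ ≤ BH) (hG : ‖constrProp (K 0) Q‖ ≤ BG)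
    (hLip : ∀ s : ℝ, |s| ≤ γ → ‖K s - K 0‖ ≤ LK * |s|)
    (hTay : ∀ h : ℝ, 0 < h → h ≤ γ → ‖(K h - K (-h)) - ((2 * h : ℂ)) • K1‖ ≤ MK * h ^ 2)
    (hLK : 0 ≤ LK) {h : ℝ} (hh : 0 < h) (hhγ : h ≤ γ) :
    ‖(minMap (K h) Q - minMap (K (-h)) Q) + ((2 * h : ℂ)) • (constrProp (K 0) Q * K1 * minMap (K 0) Q)‖
      ≤ BG * BH * (MK + 2 * BG * LK ^ 2) * h ^ 2 := by
  have hγ : 0 ≤ γ := hh.le.trans hhγ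
  have h0 : |(0:ℝ)| ≤ γ := by rwa [abs_zero]
  have hp : |h| ≤ γ := by rwa [abs_of_pos hh]
  have hm : |(-h)| ≤ γ := by rwa [abs_neg, abs_of_pos hh]
  rw [minMap_sym_diff_eq K Q K1 h (hKu 0 h0) (hKu h hp) (hKu _ hm) (hPu 0 h0) (hPu h hp) (hPu _ hm)]
  have hEp : ‖K h - K 0‖ ≤ LK * h := by simpa [abs_of_pos hh] using hLip h hp
  have hEm : ‖K (-h) - K 0‖ ≤ LK * h := by simpa [abs_neg, abs_of_pos hh] using hLip (-h) hm
  have hMK : 0 ≤ MK * h ^ 2 := (norm_nonneg _).trans (hTay h hh hhγ)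
  have hLh : 0 ≤ LK * h := by positivity
  have t1 : ‖constrProp (K 0) Q * ((K h - K (-h)) - ((2 * h : ℂ)) • K1) * minMap (K 0) Q‖ ≤ BG * (MK * h ^ 2) * BH :=
    norm_mul₃_le_of hG (hTay h hh hhγ) (hH 0 h0) hMK
  have t2 : ‖constrProp (K 0) Q * (K h - K 0) * (constrProp (K 0) Q * (K h - K 0) * minMap (K h) Q)‖
      ≤ BG * (LK * h) * (BG * (LK * h) * BH) :=
    norm_mul₃_le_of hG hEp (norm_mul₃_le_of hG hEp (hH h hp) hLh) hLh
  have t3 : ‖constrProp (K 0) Q * (K (-h) - K 0) * (constrProp (K 0) Q * (K (-h) - K 0) * minMap (K (-h)) Q)‖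
      ≤ BG * (LK * h) * (BG * (LK * h) * BH) :=
    norm_mul₃_le_of hG hEm (norm_mul₃_le_of hG hEm (hH (-h) hm) hLh) hLh
  calc _ ≤ ‖-(constrProp (K 0) Q * ((K h - K (-h)) - ((2 * h : ℂ)) • K1) * minMap (K 0) Q)‖
        + ‖constrProp (K 0) Q * (K h - K 0) * (constrProp (K 0) Q * (K h - K 0) * minMap (K h) Q)
          - constrProp (K 0) Q * (K (-h) - K 0) * (constrProp (K 0) Q * (K (-h) - K 0) * minMap (K (-h)) Q)‖ := norm_add_le _ _
    _ ≤ BG * (MK * h ^ 2) * BH + (BG * (LK * h) * (BG * (LK * h) * BH) + BG * (LK * h) * (BG * (LK * h) * BH)) := by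
        rw [norm_neg]; exact add_le_add t1 ((norm_sub_le _ _).trans (add_le_add t2 t3))
    _ = BG * BH * (MK + 2 * BG * LK ^ 2) * h ^ 2 := by ring

end Minimiser

/-! ## §4 Entry read-outs: the `taylor` field of PART 1's `TransferInput₁` for the entry families -/

section Entries

omit [Fintype ν] [DecidableEq ν] in
/-- `|Re (A y y′)| ≤ ‖A‖` (real part of an entry against the `ℓ²`-operator norm; NE2's `norm_entry_le_opNorm`). -/
theorem abs_re_entry_le_norm {m n : Type*} [Fintype m] [DecidableEq m] [Fintype n] [DecidableEq n] (A : Matrix m n ℂ)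
    (i : m) (j : n) : |(A i j).re| ≤ ‖A‖ :=
  (Complex.abs_re_le_norm _).trans (norm_entry_le_opNorm A i j)

omit [Fintype ν] [DecidableEq ν] in
/-- Entry bookkeeping: the real part of an entry of `(A − B) − (c:ℂ)•D` (`c` real) is `(Re A − Re B) − c·Re D`. -/
theorem re_entry_sub_sub_smul {m n : Type*} (A B D : Matrix m n ℂ) (c : ℝ) (i : m) (j : n) :
    (((A - B) - (c : ℂ) • D) i j).re = ((A i j).re - (B i j).re) - c * (D i j).re := by
  simp only [Matrix.sub_apply, Matrix.smul_apply, smul_eq_mul, Complex.sub_re, Complex.re_ofReal_mul]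

omit [Fintype ν] [DecidableEq ν] in
/-- Entry bookkeeping: the real part of an entry of `(A − B) + (c:ℂ)•D` (`c` real). -/
theorem re_entry_sub_add_smul {m n : Type*} (A B D : Matrix m n ℂ) (c : ℝ) (i : m) (j : n) :
    (((A - B) + (c : ℂ) • D) i j).re = ((A i j).re - (B i j).re) + c * (D i j).re := by
  simp only [Matrix.add_apply, Matrix.sub_apply, Matrix.smul_apply, smul_eq_mul, Complex.sub_re, Complex.add_re,
    Complex.re_ofReal_mul]

variable {K : ℝ → Matrix ν ν ℂ} {Q : Matrix μ ν ℂ} {K1 : Matrix ν ν ℂ} {γ BH BG LK MK : ℝ}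

/-- **Value-block ENTRIES in PART 1's Taylor form**: with `F(s) = Re (P(s)⁻¹)_{yy′}` and `dF = Re (H₀ᴸK′H₀)_{yy′}`,
`|dF·2h − (F(h) − F(−h))| ≤ B_H²(M_K + 2B_G L_K²)·h²` — literally the `taylor` field of `TransferInput₁`. -/
theorem value_taylor_form_entry_re
    (hKu : ∀ s : ℝ, |s| ≤ γ → IsUnit (K s).det) (hPu : ∀ s : ℝ, |s| ≤ γ → IsUnit (blockProp (K s) Q).det)
    (hH : ∀ s : ℝ, |s| ≤ γ → ‖minMap (K s) Q‖ ≤ BH) (hHL : ‖minMapL (K 0) Q‖ ≤ BH) (hG : ‖constrProp (K 0) Q‖ ≤ BG)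
    (hLip : ∀ s : ℝ, |s| ≤ γ → ‖K s - K 0‖ ≤ LK * |s|)
    (hTay : ∀ h : ℝ, 0 < h → h ≤ γ → ‖(K h - K (-h)) - ((2 * h : ℂ)) • K1‖ ≤ MK * h ^ 2)
    {h : ℝ} (hh : 0 < h) (hhγ : h ≤ γ) (y y' : μ) :
    |((minMapL (K 0) Q * K1 * minMap (K 0) Q) y y').re * (2 * h)
        - ((((blockProp (K h) Q)⁻¹) y y').re - (((blockProp (K (-h)) Q)⁻¹) y y').re)|
      ≤ BH ^ 2 * (MK + 2 * BG * LK ^ 2) * h ^ 2 := by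
  have hm := value_taylor_form (K1 := K1) hKu hPu hH hHL hG hLip hTay hh hhγ
  have he := re_entry_sub_sub_smul ((blockProp (K h) Q)⁻¹) ((blockProp (K (-h)) Q)⁻¹) (minMapL (K 0) Q * K1 * minMap (K 0) Q)
    (2 * h) y y'
  have hentry := abs_re_entry_le_norm
    ((((blockProp (K h) Q)⁻¹ - (blockProp (K (-h)) Q)⁻¹) - ((2 * h : ℝ) : ℂ) • (minMapL (K 0) Q * K1 * minMap (K 0) Q))) y y'
  rw [he] at hentry
  push_cast at hentry
  rw [abs_sub_comm]
  calc |(((blockProp (K h) Q)⁻¹) y y').re - (((blockProp (K (-h)) Q)⁻¹) y y').re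
          - ((minMapL (K 0) Q * K1 * minMap (K 0) Q) y y').re * (2 * h)|
      = |(((blockProp (K h) Q)⁻¹) y y').re - (((blockProp (K (-h)) Q)⁻¹) y y').re
          - 2 * h * ((minMapL (K 0) Q * K1 * minMap (K 0) Q) y y').re| := by ring_nf
    _ ≤ _ := hentry
    _ ≤ _ := hm

/-- **Minimiser-block ENTRIES in PART 1's Taylor form** (rectangular indices `y : ν`, `y′ : μ`): with `F(s) = Re H(s)_{yy′}` and
`dF = −Re (G₀K′H₀)_{yy′}`, `|dF·2h − (F(h) − F(−h))| ≤ B_G B_H(M_K + 2B_G L_K²)·h²`. -/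
theorem minMap_taylor_form_entry_re
    (hKu : ∀ s : ℝ, |s| ≤ γ → IsUnit (K s).det) (hPu : ∀ s : ℝ, |s| ≤ γ → IsUnit (blockProp (K s) Q).det)
    (hH : ∀ s : ℝ, |s| ≤ γ → ‖minMap (K s) Q‖ ≤ BH) (hG : ‖constrProp (K 0) Q‖ ≤ BG)
    (hLip : ∀ s : ℝ, |s| ≤ γ → ‖K s - K 0‖ ≤ LK * |s|)
    (hTay : ∀ h : ℝ, 0 < h → h ≤ γ → ‖(K h - K (-h)) - ((2 * h : ℂ)) • K1‖ ≤ MK * h ^ 2)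
    (hLK : 0 ≤ LK) {h : ℝ} (hh : 0 < h) (hhγ : h ≤ γ) (y : ν) (y' : μ) :
    |(-((constrProp (K 0) Q * K1 * minMap (K 0) Q) y y').re) * (2 * h)
        - (((minMap (K h) Q) y y').re - ((minMap (K (-h)) Q) y y').re)|
      ≤ BG * BH * (MK + 2 * BG * LK ^ 2) * h ^ 2 := by
  have hm := minMap_taylor_form (K1 := K1) hKu hPu hH hG hLip hTay hLK hh hhγ
  have he := re_entry_sub_add_smul (minMap (K h) Q) (minMap (K (-h)) Q) (constrProp (K 0) Q * K1 * minMap (K 0) Q) (2 * h) y y'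
  have hentry := abs_re_entry_le_norm
    (((minMap (K h) Q - minMap (K (-h)) Q) + ((2 * h : ℝ) : ℂ) • (constrProp (K 0) Q * K1 * minMap (K 0) Q))) y y'
  rw [he] at hentry
  push_cast at hentry
  rw [abs_sub_comm]
  calc |((minMap (K h) Q) y y').re - ((minMap (K (-h)) Q) y y').re
          - (-((constrProp (K 0) Q * K1 * minMap (K 0) Q) y y').re) * (2 * h)|
      = |((minMap (K h) Q) y y').re - ((minMap (K (-h)) Q) y y').re
          + 2 * h * ((constrProp (K 0) Q * K1 * minMap (K 0) Q) y y').re| := by ring_nf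
    _ ≤ _ := hentry
    _ ≤ _ := hm

end Entries

/-! ## §5 Junction with PART 1 at family level (fixed finite index sets; the value block) -/

section Family

open Summit.QuantumFields.BalabanUV.Beta.GAN24.DerivativeRateTransfer (TransferInput₁)

/-- **`TransferInput₁` FOR THE VALUE-BLOCK ENTRY FAMILY** (fixed finite index sets `ν`, `μ` — a MODEL statement; the growing-torus ∕ `ℤ^{d+1}`
bookkeeping of the cell's typing is the consumer's): for forms `K_k(s)` with the uniform-in-`k` bounds of §2 along `|s| ≤ γ` and a value-level
rate `|Re P_{k+1}(s)⁻¹_{yy′} − Re P_k(s)⁻¹_{yy′}| ≤ Cθ^k` (S1), PART 1's [shape] holds with Taylor constant `B_H²(M_K + 2B_G L_K²)`: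
hence `deriv_step_supRate` — the u-derivative insertion `Re (H₀ᴸK′_kH₀)_{yy′}` of the VALUE block is geometrically Cauchy at ratio `√θ`. -/
theorem transferInput₁_value {K : ℕ → ℝ → Matrix ν ν ℂ} {Q : Matrix μ ν ℂ} {K1 : ℕ → Matrix ν ν ℂ} {γ BH BG LK MK C θ : ℝ}
    (hKu : ∀ k (s : ℝ), |s| ≤ γ → IsUnit (K k s).det) (hPu : ∀ k (s : ℝ), |s| ≤ γ → IsUnit (blockProp (K k s) Q).det)
    (hH : ∀ k (s : ℝ), |s| ≤ γ → ‖minMap (K k s) Q‖ ≤ BH) (hHL : ∀ k, ‖minMapL (K k 0) Q‖ ≤ BH)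
    (hG : ∀ k, ‖constrProp (K k 0) Q‖ ≤ BG) (hLip : ∀ k (s : ℝ), |s| ≤ γ → ‖K k s - K k 0‖ ≤ LK * |s|)
    (hTay : ∀ k (h : ℝ), 0 < h → h ≤ γ → ‖(K k h - K k (-h)) - ((2 * h : ℂ)) • K1 k‖ ≤ MK * h ^ 2)
    (hstep : ∀ k (y y' : μ) (s : ℝ), |s| ≤ γ →
      |(((blockProp (K (k + 1) s) Q)⁻¹) y y').re - (((blockProp (K k s) Q)⁻¹) y y').re| ≤ C * θ ^ k) :
    TransferInput₁ (fun k s (y y' : μ) => (((blockProp (K k s) Q)⁻¹) y y').re)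
      (fun k (y y' : μ) => ((minMapL (K k 0) Q * K1 k * minMap (K k 0) Q) y y').re) γ (BH ^ 2 * (MK + 2 * BG * LK ^ 2)) C θ where
  taylor k y y' _ hh hhγ := value_taylor_form_entry_re (hKu k) (hPu k) (hH k) (hHL k) (hG k) (hLip k) (hTay k) hh hhγ y y'
  step := hstep

end Family

end Summit.QuantumFields.BalabanUV.Beta.GAN24.DerivativeRateTransferEnvelope
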